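import Summits.NavierStokesRegularity.NavierStokesRegularity.Theorems.RellichScarSymmetricScarExistsApexRieszPressureLemmas

/-!
# Crux `SymmetricScarExists` (stmt-NavierStokesRegularity-11718), line `logtime-bernoulli-certificate`:
# stub `stub_apexScaleInvariantBounds` — the Riesz pressure, II: the far potential and the bounds at the
# normalised parabolic scale (registered sub-goal `apexRieszPressure_unitScaleBounds`)

Helper file (`--supports stmt-NavierStokesRegularity-11718`; theorems only, no definitions, no named
facts), sequel of `…ApexRieszPressureLemmas.lean`.  For a classical Type-I solution `(w, q)` of
Navier–Stokes on the past with `‖w(s,z)‖ ≤ C/(‖z‖+√(−s))`, the pressure potential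
`Q[w(s)] = −Q₁[w(s)] − Q₂[w(s)]` (the Riesz pressure `RᵢRⱼ(wᵢwⱼ)`, `PressureRepresentation.lean`) is
bounded together with its first two derivatives, by a constant depending on `C` only, at every point of
NORMALISED parabolic size `max{‖y‖, √(−s)} = 16`:

* `far_bounds`, `exists_far_bounds` — the far potential `Q₂[v](x) = ∫ D²Γ∞(x−y)(v y, v y) dy` of a
  continuous near-singular Type-I profile `‖v(y)‖ ≤ C₀/(‖y‖ + s₀)` and its first two derivatives are
  `O(C₀²)` at points `‖x‖ ≤ 16`, uniformly in `s₀ > 0` (the decay-class derivative formulas of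
  `PineauVicolPressureDecayClass.lean` and the dominator `exists_dominator_far` for the kernels
  `D²Γ∞, D³Γ∞(·)a, D(D³Γ∞(·)a)`; the Hessian through directional kernels);
* `apexRieszPressure_unitScaleBounds` (registered sub-goal) — the bounds at the normalised scale: on the
  ball `B(y, 2)` every point has parabolic size `≥ 1`, so all derivatives of `w(s)` up to order `4` are
  bounded there by constants `Kⱼ(C)` (the tree's `PineauVicol2026.exists_forall_iteratedFDeriv_le_of_typeI`,
  Seregin–Šverák's quantitative interior regularity), hence the source `∂ᵢ∂ⱼ(wᵢwⱼ)` and the near potential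
  with two derivatives (`norm_iteratedFDeriv_pressureSource_le`, `apexRieszPressure_nearBounds`); the far
  part is `exists_far_bounds`.

The dilation covariance of `Q` and the resulting scale-invariant bounds `(‖x‖+√(−t))^{2+k}‖DᵏQ[v(t)](x)‖ ≤ K`
in physical variables are in the sequel `…ApexRieszPressureBounds.lean`.

## References

* B. Pineau, V. Vicol, arXiv:2607.09619 (2026), Lemma 2.1, Lemma 7.1. [PineauVicol2026]
* G. Seregin, V. Šverák, Comm. PDE 34 (2009) = arXiv:0804.1803, §2 p. 8. [SereginSverak2009]
-/

noncomputable section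

open MeasureTheory Set Function Filter Topology Metric
open scoped ContDiff

namespace Summit.NavierStokesRegularity.NavierStokesRegularity.Theorems.SymmetricScarExists.LogtimeBernoulli

open Literature.Analysis.FluidPDE
open Literature.Analysis.FluidPDE.FourierNS (HasDecay)
open Literature.Analysis.FluidPDE.PineauVicol2026 (newtonNearMass newtonNearMass_nonneg
  integral_closedBall_indicator_norm_sub_inv_sq_le integrable_inv_one_add_norm_pow_five
  exists_hasDecay_fderiv_newtonFar hasDecay_two_evalDiag hasFDerivAt_integral_clm_apply_comp_sub_decay)

-- nested operator types `ℝ³ →L[ℝ] ℝ³ →L[ℝ] ℝ³ →L[ℝ] ℝ`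
set_option maxSynthPendingDepth 3

/-! ### The far potential and its first two derivatives -/

section FarPart

variable {v : (EuclideanSpace ℝ (Fin 3)) → (EuclideanSpace ℝ (Fin 3))} {Cd C₀ s₀ : ℝ}
  {x : EuclideanSpace ℝ (Fin 3)}

/-- Applying an operator-valued kernel with `(1+|z|)⁻³` decay to a fixed vector keeps the decay, with constant `M‖a‖`. [folklore] -/
theorem hasDecay_clm_apply_const {M : ℝ}
    {Θ : (EuclideanSpace ℝ (Fin 3)) → (EuclideanSpace ℝ (Fin 3)) →L[ℝ]
      ((EuclideanSpace ℝ (Fin 3)) →L[ℝ] (EuclideanSpace ℝ (Fin 3)) →L[ℝ] ℝ)}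
    (hΘ : HasDecay 3 M Θ) (a : EuclideanSpace ℝ (Fin 3)) :
    HasDecay 3 (M * ‖a‖) (fun z => Θ z a) := fun z => by
  calc ‖Θ z a‖ ≤ ‖Θ z‖ * ‖a‖ := ContinuousLinearMap.le_opNorm _ _
    _ ≤ M * ((1 + ‖z‖) ^ 3)⁻¹ * ‖a‖ := mul_le_mul_of_nonneg_right (hΘ z) (norm_nonneg _)
    _ = M * ‖a‖ * ((1 + ‖z‖) ^ 3)⁻¹ := by ring

set_option maxHeartbeats 400000 in
/-- **The far potential of a near-singular Type-I profile and its first two derivatives, at points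
`‖x‖ ≤ 16`.**  For `v` continuous, in some decay class `‖v(y)‖ ≤ C_d/(1+‖y‖)` (so that the tree's
decay-class formulas for `Q₂ = ∫ D²Γ∞(x − y)(v y, v y) dy` and its derivatives apply:
`PineauVicol2026.hasFDerivAt_integral_clm_apply_comp_sub_decay`) and with the profile bound
`‖v(y)‖ ≤ C₀/(‖y‖ + s₀)`, `s₀ > 0`: `|Q₂[v](x)| ≤ M₀K_far C₀²`, `‖DQ₂[v](x)‖ ≤ M₁K_far C₀²`,
`‖D²Q₂[v](x)‖ ≤ M₂K_far C₀²`, where `Mᵢ` are the `(1+|z|)⁻³`-decay constants of `D²Γ∞, D³Γ∞, D⁴Γ∞`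
(the dominator of `exists_dominator_far` for each kernel; the second derivative through the directional
kernels `z ↦ D³Γ∞(z)a` and `‖D²F‖ ≤ sup_{‖a‖,‖h‖ ≤ 1} ‖D(x ↦ DF(x)a) h‖`). [folklore] -/
theorem far_bounds {M₀ M₁ M₂ : ℝ}
    (hM₀ : HasDecay 3 M₀ (fderiv ℝ (fderiv ℝ (newtonFar (1 : ℝ) 2))))
    (hM₁ : HasDecay 3 M₁ (fderiv ℝ (fderiv ℝ (fderiv ℝ (newtonFar (1 : ℝ) 2)))))
    (hM₂ : HasDecay 3 M₂ (fderiv ℝ (fderiv ℝ (fderiv ℝ (fderiv ℝ (newtonFar (1 : ℝ) 2))))))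
    (hvc : Continuous v) (hdec : ∀ y, ‖v y‖ ≤ Cd / (1 + ‖y‖)) (hs₀ : 0 < s₀)
    (hv : ∀ y, ‖v y‖ ≤ C₀ / (‖y‖ + s₀)) (hx : ‖x‖ ≤ 16) :
    |farPotential 1 2 v x| ≤ M₀ * (3 * (volume : Measure (EuclideanSpace ℝ (Fin 3))).real (ball 0 1) * 80 +
        256 * ∫ y : EuclideanSpace ℝ (Fin 3), ((1 + ‖y‖) ^ 5)⁻¹) * C₀ ^ 2 ∧
    ‖fderiv ℝ (farPotential 1 2 v) x‖ ≤ M₁ * (3 * (volume : Measure (EuclideanSpace ℝ (Fin 3))).real (ball 0 1) * 80 +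
        256 * ∫ y : EuclideanSpace ℝ (Fin 3), ((1 + ‖y‖) ^ 5)⁻¹) * C₀ ^ 2 ∧
    ‖iteratedFDeriv ℝ 2 (farPotential 1 2 v) x‖ ≤ M₂ * (3 * (volume : Measure (EuclideanSpace ℝ (Fin 3))).real (ball 0 1) * 80 +
        256 * ∫ y : EuclideanSpace ℝ (Fin 3), ((1 + ‖y‖) ^ 5)⁻¹) * C₀ ^ 2 := by
  set Kf : ℝ := 3 * (volume : Measure (EuclideanSpace ℝ (Fin 3))).real (ball 0 1) * 80 +
        256 * ∫ y : EuclideanSpace ℝ (Fin 3), ((1 + ‖y‖) ^ 5)⁻¹ with hKf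
  have hKf0 : 0 ≤ Kf := farConst_nonneg
  set Φ := fderiv ℝ (fderiv ℝ (newtonFar (1 : ℝ) 2)) with hΦ
  have hΦ2 : ContDiff ℝ 2 Φ := contDiff_fderiv2_newtonFar one_pos one_lt_two
  have hΦ1 : ContDiff ℝ 1 Φ := hΦ2.of_le one_le_two
  have hDΦ1 : ContDiff ℝ 1 (fderiv ℝ Φ) := hΦ2.fderiv_right (m := 1) le_rfl
  set L : (EuclideanSpace ℝ (Fin 3)) → ((EuclideanSpace ℝ (Fin 3)) →L[ℝ] (EuclideanSpace ℝ (Fin 3)) →L[ℝ] ℝ) →L[ℝ] ℝ :=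
    fun y => evalDiag (v y) with hL
  have hLc : Continuous L := continuous_evalDiag.comp hvc
  have hLd : HasDecay 2 (Cd ^ 2) L := hasDecay_two_evalDiag hdec
  have hLn : ∀ y, ‖L y‖ ≤ ‖v y‖ ^ 2 := fun y => norm_evalDiag_le (v y)
  have eF : farPotential 1 2 v = fun x => ∫ y, L y (Φ (x - y)) := farPotential_eq 1 2 v
  have hcomp : ∀ (y : EuclideanSpace ℝ (Fin 3))
      (T : (EuclideanSpace ℝ (Fin 3)) →L[ℝ] ((EuclideanSpace ℝ (Fin 3)) →L[ℝ] (EuclideanSpace ℝ (Fin 3)) →L[ℝ] ℝ)),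
      ‖(L y).comp T‖ ≤ ‖T‖ * ‖v y‖ ^ 2 := fun y T =>
    (ContinuousLinearMap.opNorm_comp_le _ _).trans (by rw [mul_comm]; exact mul_le_mul_of_nonneg_left (hLn y) (norm_nonneg _))
  refine ⟨?_, ?_, ?_⟩
  · -- (0) the potential itself
    obtain ⟨g, hgi, hae, hgint⟩ := exists_dominator_far hM₀ hs₀ hv hx
    rw [← Real.norm_eq_abs, eF]
    refine (norm_integral_le_of_dominator hgi hae fun y => ?_).trans hgint
    calc ‖L y (Φ (x - y))‖ ≤ ‖L y‖ * ‖Φ (x - y)‖ := ContinuousLinearMap.le_opNorm _ _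
      _ ≤ ‖v y‖ ^ 2 * ‖Φ (x - y)‖ := mul_le_mul_of_nonneg_right (hLn y) (norm_nonneg _)
      _ = ‖Φ (x - y)‖ * ‖v y‖ ^ 2 := mul_comm _ _
  · -- (1) the first derivative
    obtain ⟨g, hgi, hae, hgint⟩ := exists_dominator_far hM₁ hs₀ hv hx
    rw [eF, (hasFDerivAt_integral_clm_apply_comp_sub_decay hΦ1 hM₀ hM₁ hLc hLd x).fderiv]
    exact (norm_integral_le_of_dominator hgi hae fun y => hcomp y _).trans hgint
  · -- (2) the second derivative, through the directional kernels `z ↦ DΦ(z) a`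
    have hdir : ∀ a : EuclideanSpace ℝ (Fin 3),
        ‖fderiv ℝ (fun x' => fderiv ℝ (farPotential 1 2 v) x' a) x‖ ≤ M₂ * ‖a‖ * Kf * C₀ ^ 2 := by
      intro a
      set Φa : (EuclideanSpace ℝ (Fin 3)) → ((EuclideanSpace ℝ (Fin 3)) →L[ℝ] (EuclideanSpace ℝ (Fin 3)) →L[ℝ] ℝ) :=
        fun z => fderiv ℝ Φ z a with hΦa
      have hΦa1 : ContDiff ℝ 1 Φa := hDΦ1.clm_apply contDiff_const
      have hΦa0 : HasDecay 3 (M₁ * ‖a‖) Φa := hasDecay_clm_apply_const hM₁ a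
      have hDΦa : ∀ z, fderiv ℝ Φa z = (fderiv ℝ (fderiv ℝ Φ) z).flip a := by
        intro z
        have hd : DifferentiableAt ℝ (fderiv ℝ Φ) z := (hDΦ1.differentiable one_ne_zero) z
        rw [hΦa, fderiv_clm_apply hd (differentiableAt_const a)]
        simp only [fderiv_fun_const, Pi.zero_apply, ContinuousLinearMap.comp_zero, zero_add]
      have hΦa1d : HasDecay 3 (M₂ * ‖a‖) (fderiv ℝ Φa) := fun z => by
        rw [hDΦa z]
        calc ‖(fderiv ℝ (fderiv ℝ Φ) z).flip a‖ ≤ ‖(fderiv ℝ (fderiv ℝ Φ) z).flip‖ * ‖a‖ :=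
              ContinuousLinearMap.le_opNorm _ _
          _ = ‖fderiv ℝ (fderiv ℝ Φ) z‖ * ‖a‖ := by rw [ContinuousLinearMap.opNorm_flip]
          _ ≤ M₂ * ((1 + ‖z‖) ^ 3)⁻¹ * ‖a‖ := mul_le_mul_of_nonneg_right (hM₂ z) (norm_nonneg _)
          _ = M₂ * ‖a‖ * ((1 + ‖z‖) ^ 3)⁻¹ := by ring
      have eFa : (fun x' => fderiv ℝ (farPotential 1 2 v) x' a) = fun x' => ∫ y, L y (Φa (x' - y)) := by
        funext x'
        rw [eF]
        exact PineauVicol2026.fderiv_integral_clm_apply_comp_sub_apply_decay hΦ1 hM₀ hM₁ hLc hLd x' a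
      obtain ⟨g, hgi, hae, hgint⟩ := exists_dominator_far hΦa1d hs₀ hv hx
      rw [eFa, (hasFDerivAt_integral_clm_apply_comp_sub_decay hΦa1 hΦa0 hΦa1d hLc hLd x).fderiv]
      exact (norm_integral_le_of_dominator hgi hae fun y => hcomp y _).trans hgint
    -- from directional bounds to the norm of `D²F`
    have hF2 : ContDiff ℝ 2 (farPotential 1 2 v) :=
      (PineauVicol2026.contDiff_farPotential_decay one_pos one_lt_two hvc hdec).1
    have happ : ∀ m : Fin 2 → EuclideanSpace ℝ (Fin 3),
        iteratedFDeriv ℝ 2 (farPotential 1 2 v) x m =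
          fderiv ℝ (fun x' => fderiv ℝ (farPotential 1 2 v) x' (m 1)) x (m 0) := by
      intro m
      rw [iteratedFDeriv_two_apply]
      have hd : DifferentiableAt ℝ (fderiv ℝ (farPotential 1 2 v)) x :=
        ((hF2.fderiv_right (m := 1) le_rfl).differentiable one_ne_zero) x
      rw [fderiv_clm_apply hd (differentiableAt_const (m 1))]
      simp only [fderiv_fun_const, Pi.zero_apply, ContinuousLinearMap.comp_zero, zero_add,
        ContinuousLinearMap.flip_apply]
    have hM₂0 : 0 ≤ M₂ := hM₂.nonneg
    refine ContinuousMultilinearMap.opNorm_le_bound (by positivity) (fun m => ?_)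
    rw [happ m, Fin.prod_univ_two]
    calc ‖fderiv ℝ (fun x' => fderiv ℝ (farPotential 1 2 v) x' (m 1)) x (m 0)‖
        ≤ ‖fderiv ℝ (fun x' => fderiv ℝ (farPotential 1 2 v) x' (m 1)) x‖ * ‖m 0‖ :=
          ContinuousLinearMap.le_opNorm _ _
      _ ≤ M₂ * ‖m 1‖ * Kf * C₀ ^ 2 * ‖m 0‖ := mul_le_mul_of_nonneg_right (hdir (m 1)) (norm_nonneg _)
      _ = M₂ * Kf * C₀ ^ 2 * (‖m 0‖ * ‖m 1‖) := by ring

end FarPart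

/-- **Uniform far-potential bounds**: one constant `K_f ≥ 0` with `|Q₂[v](x)|, ‖DQ₂[v](x)‖, ‖D²Q₂[v](x)‖ ≤ K_f C₀²`
for all `‖x‖ ≤ 16` and all continuous near-singular Type-I profiles `‖v(y)‖ ≤ C₀/(‖y‖ + s₀)` (any `s₀ > 0`) lying in some
decay class (`far_bounds` with the decay constants of `PineauVicol2026.exists_hasDecay_fderiv_newtonFar`). [folklore] -/
theorem exists_far_bounds :
    ∃ K : ℝ, 0 ≤ K ∧ ∀ (v : (EuclideanSpace ℝ (Fin 3)) → (EuclideanSpace ℝ (Fin 3))) (Cd C₀ s₀ : ℝ),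
      Continuous v → (∀ y, ‖v y‖ ≤ Cd / (1 + ‖y‖)) → 0 < s₀ →
      (∀ y, ‖v y‖ ≤ C₀ / (‖y‖ + s₀)) →
      ∀ x : EuclideanSpace ℝ (Fin 3), ‖x‖ ≤ 16 →
        |farPotential 1 2 v x| ≤ K * C₀ ^ 2 ∧
        ‖fderiv ℝ (farPotential 1 2 v) x‖ ≤ K * C₀ ^ 2 ∧
        ‖iteratedFDeriv ℝ 2 (farPotential 1 2 v) x‖ ≤ K * C₀ ^ 2 := by
  obtain ⟨⟨M₀, hM₀⟩, ⟨M₁, hM₁⟩, ⟨M₂, hM₂⟩⟩ := exists_hasDecay_fderiv_newtonFar (r₀ := (1 : ℝ)) (r₁ := 2)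
    one_pos one_lt_two
  set Kf : ℝ := 3 * (volume : Measure (EuclideanSpace ℝ (Fin 3))).real (ball 0 1) * 80 +
        256 * ∫ y : EuclideanSpace ℝ (Fin 3), ((1 + ‖y‖) ^ 5)⁻¹ with hKf
  have hKf0 : 0 ≤ Kf := farConst_nonneg
  have h0 := hM₀.nonneg; have h1 := hM₁.nonneg; have h2 := hM₂.nonneg
  refine ⟨(M₀ + M₁ + M₂) * Kf, by positivity, fun v Cd C₀ s₀ hvc hdec hs₀ hv x hx => ?_⟩
  obtain ⟨b0, b1, b2⟩ := far_bounds hM₀ hM₁ hM₂ hvc hdec hs₀ hv hx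
  have hC2 : 0 ≤ Kf * C₀ ^ 2 := by positivity
  refine ⟨b0.trans ?_, b1.trans ?_, b2.trans ?_⟩ <;> nlinarith





/-! ### The bounds at the normalised parabolic scale `16` -/

/-- Geometry of the normalised point: if `max{‖y‖, σ} = 16` (`σ = √(−s)`) then every point of the ball
`B(y, 2)` has parabolic size `max{‖y − z‖, σ} ≥ 1`. [folklore] -/
theorem one_le_max_of_normalised {y z : EuclideanSpace ℝ (Fin 3)} {σ : ℝ}
    (hy : max ‖y‖ σ = 16) (hz : ‖z‖ ≤ 2) : 1 ≤ max ‖y - z‖ σ := by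
  by_cases h : 1 ≤ σ
  · exact le_max_of_le_right h
  · have hy16 : ‖y‖ = 16 := by
      rcases max_choice ‖y‖ σ with hm | hm
      · rw [← hm]; exact hy
      · rw [hm] at hy; linarith [not_le.1 h]
    have : 14 ≤ ‖y - z‖ := by
      have := norm_sub_norm_le y z
      linarith
    exact le_max_of_le_left (by linarith)

/-- **Registered sub-goal `apexRieszPressure_unitScaleBounds`: the Riesz pressure of a classical Type-I
solution at the normalised parabolic scale.**  For every Type-I constant `C` there is `K = K(C)` such that
for every classical solution `(w, q)` of Navier–Stokes (`ν = 1`, `f = 0`) on `(−∞, 0)` with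
`‖w(s,z)‖ ≤ C/(‖z‖ + √(−s))` and every point with `max{‖y‖, √(−s)} = 16`:
`|Q[w(s)](y)| ≤ K`, `‖DQ[w(s)](y)‖ ≤ K`, `‖D²Q[w(s)](y)‖ ≤ K` (`Q = pressurePotential`).  Proof: on
`B(y, 2)` all points have parabolic size `≥ 1`, so `‖Dʲw(s)‖ ≤ Kⱼ(C)` there for `j ≤ 4` (the tree's
`PineauVicol2026.exists_forall_iteratedFDeriv_le_of_typeI`) and `‖w(s)‖ ≤ C`; hence the source and its two
derivatives are bounded (`norm_iteratedFDeriv_pressureSource_le`) and so is the near part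
(`apexRieszPressure_nearBounds`); the far part is `exists_far_bounds` (`‖y‖ ≤ 16`, vertex at the origin);
`Q = −Q₁ − Q₂`. [cite: PineauVicol2026, Lemma 2.1 and Lemma 7.1 (proofs, pp. 9–10 and 23–24)] -/
theorem apexRieszPressure_unitScaleBounds :
    ∀ (C : ℝ), ∃ (K : ℝ), 0 ≤ K ∧ ∀ (w : ℝ → EuclideanSpace ℝ (Fin 3) → EuclideanSpace ℝ (Fin 3)) (q : ℝ → EuclideanSpace ℝ (Fin 3) → ℝ), Literature.Analysis.FluidPDE.IsClassicalNSSolutionOn (Set.Iio 0) 1 0 w q → Literature.Analysis.FluidPDE.HasTypeIDecay C w → ∀ s < (0 : ℝ), ∀ (y : EuclideanSpace ℝ (Fin 3)), max ‖y‖ (Real.sqrt (-s)) = 16 → |Literature.Analysis.FluidPDE.pressurePotential (w s) y| ≤ K ∧ ‖fderiv ℝ (Literature.Analysis.FluidPDE.pressurePotential (w s)) y‖ ≤ K ∧ ‖iteratedFDeriv ℝ 2 (Literature.Analysis.FluidPDE.pressurePotential (w s)) y‖ ≤ K := by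
  intro C
  -- constants
  obtain ⟨K₁, hK₁0, hK₁⟩ := PineauVicol2026.exists_forall_iteratedFDeriv_le_of_typeI 1 C
  obtain ⟨K₂, hK₂0, hK₂⟩ := PineauVicol2026.exists_forall_iteratedFDeriv_le_of_typeI 2 C
  obtain ⟨K₃, hK₃0, hK₃⟩ := PineauVicol2026.exists_forall_iteratedFDeriv_le_of_typeI 3 C
  obtain ⟨K₄, hK₄0, hK₄⟩ := PineauVicol2026.exists_forall_iteratedFDeriv_le_of_typeI 4 C
  obtain ⟨Kf, hKf0, hKf⟩ := exists_far_bounds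
  set T : ℝ := ‖(traceCLM : ((EuclideanSpace ℝ (Fin 3)) →L[ℝ] (EuclideanSpace ℝ (Fin 3))) →L[ℝ] ℝ)‖
    with hT
  have hT0 : 0 ≤ T := norm_nonneg _
  set B : ℝ := |C| + K₁ + K₂ + K₃ + K₄ with hB
  have hB0 : 0 ≤ B := by rw [hB]; positivity
  set S : ℝ := T * ((1 + T) * (2 ^ 3 * B ^ 2)) with hS
  have hS0 : 0 ≤ S := by rw [hS]; positivity
  have hN0 : 0 ≤ newtonNearMass := newtonNearMass_nonneg
  refine ⟨newtonNearMass * S + Kf * C ^ 2, by positivity, fun w q hsol hdec s hs y hy => ?_⟩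
  -- the slice, its profile and its decay class
  set ws := w s with hws_def
  have hws : ContDiff ℝ ∞ ws := hsol.contDiff_velocity hs
  have hws4 : ContDiff ℝ 4 ws := hws.of_le (by norm_cast)
  set σ : ℝ := Real.sqrt (-s) with hσ
  have hσ0 : 0 < σ := Real.sqrt_pos.2 (by linarith)
  have hv : ∀ z, ‖ws z‖ ≤ C / (‖z‖ + σ) := fun z => hdec s hs z
  have hC0 : 0 ≤ C := by
    have h := (norm_nonneg _).trans (hv 0)
    rw [norm_zero, zero_add] at h
    exact (div_nonneg_iff.1 h).elim (fun h => h.1) fun h => absurd h.2 (not_le.2 hσ0)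
  have hv' : ∀ z, ‖ws z‖ ≤ C / (‖z - 0‖ + σ) := fun z => by rw [sub_zero]; exact hv z
  set Cd : ℝ := C * (1 + ‖(0 : EuclideanSpace ℝ (Fin 3))‖ + σ) / min σ 1 with hCd
  have hdecay : ∀ z, ‖ws z‖ ≤ Cd / (1 + ‖z‖) := fun z => PineauVicol2026.decay_of_profile hσ0 hv' z
  have hy16 : ‖y‖ ≤ 16 := by rw [← hy]; exact le_max_left _ _
  -- derivative bounds on the ball `B(y, 2)`
  have hmax : ∀ z : EuclideanSpace ℝ (Fin 3), ‖z‖ ≤ 2 → 1 ≤ max ‖y - z‖ σ := fun z hz =>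
    one_le_max_of_normalised hy hz
  have hinv : ∀ z : EuclideanSpace ℝ (Fin 3), ‖z‖ ≤ 2 → ∀ n : ℕ, ((max ‖y - z‖ σ)⁻¹) ^ (n + 1) ≤ 1 :=
    fun z hz n => pow_le_one₀ (inv_nonneg.2 (le_trans zero_le_one (hmax z hz)))
      (inv_le_one_of_one_le₀ (hmax z hz))
  have hBall : ∀ z : EuclideanSpace ℝ (Fin 3), ‖z‖ ≤ 2 → ∀ j ≤ 4, ‖iteratedFDeriv ℝ j ws (y - z)‖ ≤ B := by
    intro z hz j hj
    have hs' : s ∈ Iio (0 : ℝ) := hs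
    interval_cases j
    · rw [norm_iteratedFDeriv_zero]
      have hden : 1 ≤ ‖y - z‖ + σ :=
        (hmax z hz).trans (max_le (le_add_of_nonneg_right hσ0.le) (le_add_of_nonneg_left (norm_nonneg _)))
      calc ‖ws (y - z)‖ ≤ C / (‖y - z‖ + σ) := hv _
        _ ≤ C / 1 := div_le_div_of_nonneg_left hC0 one_pos hden
        _ = C := div_one C
        _ ≤ |C| := le_abs_self C
        _ ≤ B := by rw [hB]; linarith
    · calc ‖iteratedFDeriv ℝ 1 ws (y - z)‖ ≤ K₁ * ((max ‖y - z‖ σ)⁻¹) ^ (1 + 1) :=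
            hK₁ w q hsol (fun t ht x => hdec t ht x) s hs' (y - z)
        _ ≤ K₁ * 1 := mul_le_mul_of_nonneg_left (hinv z hz 1) hK₁0
        _ ≤ B := by rw [hB, mul_one]; linarith [abs_nonneg C]
    · calc ‖iteratedFDeriv ℝ 2 ws (y - z)‖ ≤ K₂ * ((max ‖y - z‖ σ)⁻¹) ^ (2 + 1) :=
            hK₂ w q hsol (fun t ht x => hdec t ht x) s hs' (y - z)
        _ ≤ K₂ * 1 := mul_le_mul_of_nonneg_left (hinv z hz 2) hK₂0
        _ ≤ B := by rw [hB, mul_one]; linarith [abs_nonneg C]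
    · calc ‖iteratedFDeriv ℝ 3 ws (y - z)‖ ≤ K₃ * ((max ‖y - z‖ σ)⁻¹) ^ (3 + 1) :=
            hK₃ w q hsol (fun t ht x => hdec t ht x) s hs' (y - z)
        _ ≤ K₃ * 1 := mul_le_mul_of_nonneg_left (hinv z hz 3) hK₃0
        _ ≤ B := by rw [hB, mul_one]; linarith [abs_nonneg C]
    · calc ‖iteratedFDeriv ℝ 4 ws (y - z)‖ ≤ K₄ * ((max ‖y - z‖ σ)⁻¹) ^ (4 + 1) :=
            hK₄ w q hsol (fun t ht x => hdec t ht x) s hs' (y - z)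
        _ ≤ K₄ * 1 := mul_le_mul_of_nonneg_left (hinv z hz 4) hK₄0
        _ ≤ B := by rw [hB, mul_one]; linarith [abs_nonneg C]
  -- the source and its first two derivatives on `B(y, 2)`
  have hpow : ∀ k ≤ 2, T * ((1 + T) * (2 ^ (k + 1) * B ^ 2)) ≤ S := by
    intro k hk
    rw [hS]
    have h2 : (2 : ℝ) ^ (k + 1) ≤ 2 ^ 3 := pow_le_pow_right₀ (by norm_num) (by omega)
    have : 0 ≤ T * (1 + T) := by positivity
    nlinarith [sq_nonneg B, mul_nonneg this (sq_nonneg B)]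
  have hG0 : ∀ z : EuclideanSpace ℝ (Fin 3), ‖z‖ ≤ 2 → ‖pressureSource ws (y - z)‖ ≤ S := by
    intro z hz
    rw [← norm_iteratedFDeriv_zero (𝕜 := ℝ) (f := pressureSource ws)]
    exact (norm_iteratedFDeriv_pressureSource_le hws 0 hB0 (y - z) fun j hj => hBall z hz j (by omega)).trans
      (hpow 0 (by norm_num))
  have hG1 : ∀ z : EuclideanSpace ℝ (Fin 3), ‖z‖ ≤ 2 → ‖fderiv ℝ (pressureSource ws) (y - z)‖ ≤ S := by
    intro z hz
    rw [← norm_iteratedFDeriv_one (f := pressureSource ws)]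
    exact (norm_iteratedFDeriv_pressureSource_le hws 1 hB0 (y - z) fun j hj => hBall z hz j (by omega)).trans
      (hpow 1 (by norm_num))
  have hG2 : ∀ z : EuclideanSpace ℝ (Fin 3), ‖z‖ ≤ 2 →
      ‖fderiv ℝ (fderiv ℝ (pressureSource ws)) (y - z)‖ ≤ S := by
    intro z hz
    rw [← norm_iteratedFDeriv_one (f := fderiv ℝ (pressureSource ws)), norm_iteratedFDeriv_fderiv]
    exact (norm_iteratedFDeriv_pressureSource_le hws 2 hB0 (y - z) fun j hj => hBall z hz j (by omega)).trans
      (hpow 2 le_rfl)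
  obtain ⟨n0, n1, n2⟩ := apexRieszPressure_nearBounds ws hws y S S S hG0 hG1 hG2
  obtain ⟨f0, f1, f2⟩ := hKf ws Cd C σ hws.continuous hdecay hσ0 hv y hy16
  -- the potential is `-N - F`
  have hN2 : ContDiff ℝ 2 (nearPotential 1 2 ws) :=
    contDiff_nearPotential zero_le_one one_lt_two 2 (by exact_mod_cast hws4)
  have hF2 : ContDiff ℝ 2 (farPotential 1 2 ws) :=
    (PineauVicol2026.contDiff_farPotential_decay one_pos one_lt_two hws.continuous hdecay).1
  have eQ : pressurePotential ws = (-nearPotential 1 2 ws) - farPotential 1 2 ws := by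
    funext x; simp only [pressurePotential, Pi.sub_apply, Pi.neg_apply]
  refine ⟨?_, ?_, ?_⟩
  · rw [pressurePotential]
    calc |-nearPotential 1 2 ws y - farPotential 1 2 ws y|
        ≤ |nearPotential 1 2 ws y| + |farPotential 1 2 ws y| := by
          rw [show -nearPotential 1 2 ws y - farPotential 1 2 ws y =
            -(nearPotential 1 2 ws y + farPotential 1 2 ws y) by ring, abs_neg]
          exact abs_add_le _ _
      _ ≤ newtonNearMass * S + Kf * C ^ 2 := add_le_add n0 f0
  · rw [eQ, fderiv_sub ((hN2.differentiable two_ne_zero) y).neg ((hF2.differentiable two_ne_zero) y),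
      fderiv_neg]
    calc ‖-fderiv ℝ (nearPotential 1 2 ws) y - fderiv ℝ (farPotential 1 2 ws) y‖
        ≤ ‖-fderiv ℝ (nearPotential 1 2 ws) y‖ + ‖fderiv ℝ (farPotential 1 2 ws) y‖ := norm_sub_le _ _
      _ ≤ newtonNearMass * S + Kf * C ^ 2 := by rw [norm_neg]; exact add_le_add n1 f1
  · have hNn : ContDiff ℝ 2 (-nearPotential 1 2 ws) := hN2.neg
    rw [eQ, iteratedFDeriv_sub_apply hNn.contDiffAt hF2.contDiffAt, iteratedFDeriv_neg_apply]
    calc ‖-iteratedFDeriv ℝ 2 (nearPotential 1 2 ws) y - iteratedFDeriv ℝ 2 (farPotential 1 2 ws) y‖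
        ≤ ‖-iteratedFDeriv ℝ 2 (nearPotential 1 2 ws) y‖ + ‖iteratedFDeriv ℝ 2 (farPotential 1 2 ws) y‖ :=
          norm_sub_le _ _
      _ ≤ newtonNearMass * S + Kf * C ^ 2 := by rw [norm_neg]; exact add_le_add n2 f2





end Summit.NavierStokesRegularity.NavierStokesRegularity.Theorems.SymmetricScarExists.LogtimeBernoulli
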